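/-
Copyright (c) 2026 the pub-hodgecm-mathlib formalisation cell (harness21).  Prover seat hodgecm-mathlib-K2E1-p13 (g4), Track B ∕ K2-LIT, h413 = `stmt-HodgeConjecture-24833`,
R90-TF section S8 «ContSpec-n½», #2 chain (G side), deal S8-R72∕R79 of R90-CS-plan (g2), (XF)₃ sub-cut C1 (census `R90/S8/CENSUS-XF3.K2E1-p13-g4.md`): W-a₃ — the
`(χ₁, χ₂)`-PAIR-SECTION data of `U(J₃)` along the adelic torus `t·K_U`; the N = 3 twin of ★ W-a `K2E1ChiSectionTorusAverageU2` (K2E3-p12) with the extra middle `U(1)`-character.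
-/
import Summits.HodgeConjecture.HodgeConjecture.Theorems.K2E1ChiIntertwinedSectionU3                 -- ★ row 4a (K2-defs1 g7): pair sections, N = 3 torus scaling `integral_flatSectionU_weylLongU_torus_mul_of_isChiSectionPair`, `chi_torus_last_eq_reflectChar`
import Summits.HodgeConjecture.HodgeConjecture.Theorems.K2E1ChiSectionSpaceU2Defs                   -- ★ `firstEntryUnit_eq_diagUnit_zero` (every rank)
import Summits.HodgeConjecture.HodgeConjecture.Theorems.K2E1EisensteinPairingUnfolded              -- ★ p857542: `torusRootModulus_diagUnit_torus_eq_ideleNorm_mul` (`δ_B = ‖d₀‖²` at N = 3); brings ★ `K2E1BorelParabolicIntegralU3`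
import Literature.NumberTheory.Automorphic.UnitaryGroupBorelTorusUnipotentCoordinates               -- ★ `glDiagonal_diagUnit_torus`
import Literature.NumberTheory.Automorphic.UnitaryGroupCuspIntegralSiegelMajorant                   -- ★ `borelHeight_mul_of_mem_comap_standardMaximalCompactGL`
import HarnessLib

/-!
# (XF)₃ C1 = W-a₃ — `K2E1ChiSectionTorusAverageU3`: THE `K_U`-AVERAGES ALONG `t·K_U` OF `(χ₁, χ₂)`-PAIR-SECTION DATA OF `U(J₃)` — `φ(t g) = χ₁(d₀ t)·χ₂(t₁₁)·φ(g)`, `H(t k) = ‖d₀ t‖`,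
# the torus scaling of the intertwining integral in `d₀`-currency (`δ_B = ‖d₀‖²`), and the two averages `∫_K g₁(H)·φ·conj(g₂(H)·φ′)`, `∫_K g₁(H)·φ·conj(∫_ℝ G·M(·))` along `t·K_U`

Track B ∕ K2-LIT, crux h413 = `stmt-HodgeConjecture-24833`, route of record `HCCMUnconditional`; cell `hodgecm-mathlib`, R90-TF programme, section S8 «ContSpec-n½», #2 chain, letter
(XF)₃ of ★ `K2E1ChiPseudoEisensteinFamiliesOrthogonalCMThree` (CLOSURE TARGET R90_CLOSURE_DAG row T2.1; xref E2.G8.R1 (δ)).  THEOREMS ONLY (no `def`, no `instance`, no `notation`,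
no named-fact hypothesis, no `sorry`; default heartbeats); lane `--supports stmt-HodgeConjecture-24833 --as helper` (count-neutral).  Generic quasi-split datum `(F, E, c)` with
`c² = 1`, `c ≠ 1` where needed; pays no socket — it is the first of four sub-cuts (C1 W-a₃ · C2 D0-χ₃ · C3 W-b₃+H-a₃ · C4 H-b₃ = (XF)₃).

THE MATHEMATICS ([MoeglinWaldspurger1995] II.1.6–II.1.7, II.2.1; [Rogawski1990] §1.10 p. 9, §7.3 pp. 96–98, §13.9 p. 229; [GelbartRogawski1991] §3.1).  `G = U(J₃)`, `B = T N`,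
`T(𝔸_F) = {diag(a, u, ā⁻¹)}` read through `d₀ t = a = t₀₀ ∈ 𝕀_E` (★ `diagUnit … 0`) and the middle entry `t₁₁ = u ∈ U(1)(𝔸_F)` (★ `middleEntryUnitary`).  A `(χ₁, χ₂)`-pair-section
(★ `IsChiSectionPair`: `φ(b g) = χ₁(b₀₀)·χ₂(b₁₁)·φ(g)`) therefore satisfies `φ(t g) = χ₁(d₀ t)·χ₂(t₁₁)·φ(g)` (§1), the height is `H(t k) = ‖d₀ t‖` (§1, ★ every rank), and the
intertwining integral `I(z, g) = ∫_{N(𝔸)} f_z(w₀ v g) dν` scales along the torus by `δ_B(t)·χ₁ʷ(d₀ t)·χ₂(t₁₁)·(‖d₀ t‖⁻¹)^z` with `δ_B(t) = ‖d₀ t‖²` at N = 3 (§2: ★ row 4a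
`integral_flatSectionU_weylLongU_torus_mul_of_isChiSectionPair` at `d = diagUnit t` + ★ `torusRootModulus_diagUnit_torus_eq_ideleNorm_mul` + ★ `chi_torus_last_eq_reflectChar`;
`χ₁ʷ = reflectChar c χ₁`, the middle character is NOT reflected).  §3 are the two POINTWISE `K_U`-averages along `t·K_U` that the unfolded inner product of two twisted pseudo-Eisenstein
series needs (the `hΨΦ` data of the bracket; N = 3 twins of ★ W-a §3): the `w = 1` term carries the TORUS CHARACTER `(χ₁·conj χ₁′)(d₀ t)·(χ₂·conj χ₂′)(t₁₁)` and the `w = w₀` term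
`(χ₁·conj χ₁′ʷ)(d₀ t)·(χ₂·conj χ₂′)(t₁₁)` — exactly the characters `η_1`, `η_{w₀}` of the census's dichotomy (★ R6f(i) on the `U(1)`-fibre when `χ₂ ≠ χ₂′`, ★ GR-χ Lemma B on `d₀`).
* §1 `apply_torus_mul_of_isChiSectionPair`, `borelHeight_torus_mul_maximalCompact_three`.  * §2 **`integral_flatSectionU_weylLongU_torus_mul_eq_diagUnit_three`**.
* §3 **`integral_maximalCompact_torus_chiSectionPair_mul_conj`**, **`integral_maximalCompact_torus_chiSectionPair_mul_conj_intertwined`**.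
HONEST LABEL: HC_CM is proved only modulo the 7 printed citations (2 remaining named inputs: hLiu418 = `stmt-HodgeConjecture-24832`, h413 = `stmt-HodgeConjecture-24833`) until rung 0
closes; REL ≠ ★ ≠ BUILT; this file asserts no named fact and closes no socket; count-neutral; letter-free.

## References
* [MoeglinWaldspurger1995] C. Mœglin, J.-L. Waldspurger, *Spectral Decomposition and Eisenstein Series* (1995), II.1.6–II.1.7, II.2.1.
* [Rogawski1990] J. D. Rogawski, *Automorphic Representations of Unitary Groups in Three Variables* (1990), §1.10 p. 9, §2.2 p. 13, §7.3 pp. 96–98, §13.9 p. 229.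
* [GelbartRogawski1991] S. Gelbart, J. Rogawski, *L-functions and Fourier–Jacobi coefficients for the unitary group U(3)*, Invent. Math. 105 (1991), §3.1.
-/

set_option autoImplicit false
set_option linter.dupNamespace false  -- the mandated namespace repeats the summit's segment (`HodgeConjecture.HodgeConjecture`)

noncomputable section

open MeasureTheory Measure NumberField IsDedekindDomain Matrix
open scoped ENNReal NNReal MatrixGroups ComplexConjugate
open Literature.NumberTheory Literature.NumberTheory.Automorphic Literature.NumberTheory.Automorphic.UnitaryGroup AdelicGroupData
open Literature.NumberTheory.GaloisRepresentations (HeckeCharacter ideleGroup)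
open Literature.NumberTheory.Automorphic.Arthur2013.Leaves.TECR
open Summit.HodgeConjecture.HodgeConjecture.Cruxes.H413.K2E1BorelEisensteinU
open Summit.HodgeConjecture.HodgeConjecture.Cruxes.H413.K2E1CharacterEisensteinU2Defs
open Summit.HodgeConjecture.HodgeConjecture.Cruxes.H413.K2E1CharacterEisensteinU3PairDefs
open Summit.HodgeConjecture.HodgeConjecture.Cruxes.H413.K2E1ChiSectionSpaceU2Defs (firstEntryUnit_eq_diagUnit_zero)
open Summit.HodgeConjecture.HodgeConjecture.Cruxes.H413.K2E1ChiIntertwinedSectionU3 (integral_flatSectionU_weylLongU_torus_mul_of_isChiSectionPair chi_torus_last_eq_reflectChar)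
open Summit.HodgeConjecture.HodgeConjecture.Cruxes.H413.K2E1EisensteinPairingUnfolded (torusRootModulus_diagUnit_torus_eq_ideleNorm_mul)

namespace Summit.HodgeConjecture.HodgeConjecture.Cruxes.H413.K2E1ChiSectionTorusAverageU3

variable {F E : Type} [Field F] [NumberField F] [Field E] [NumberField E] [Algebra F E] {c : E ≃ₐ[F] E}

/-! ## §1 Pair sections along the torus: `φ(t g) = χ₁(d₀ t)·χ₂(t₁₁)·φ(g)`; `H(t k) = ‖d₀ t‖` -/

/-- **`φ(t g) = χ₁(d₀ t)·χ₂(t₁₁)·φ(g)`** for a `(χ₁, χ₂)`-pair-section `φ` and `t ∈ T(𝔸_F)` (★ `IsChiSectionPair.borel_mul`, ★ `firstEntryUnit_eq_diagUnit_zero`). [cite: Rogawski1990, §13.9 p. 229]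
[cite: MoeglinWaldspurger1995, II.1.7] -/
theorem apply_torus_mul_of_isChiSectionPair {χ₁ : HeckeCharacter E} {χ₂ : ↥(TorusDict.torus c) →ₜ* ℂˣ} {φ : (quasiSplit F E c 3).Adelic → ℂ} (hφ : IsChiSectionPair χ₁ χ₂ φ)
    (t : ↥(torusInBorel F E c 3)) (y : (quasiSplit F E c 3).Adelic) :
    φ (((t : borelAdelic F E c 3) : (quasiSplit F E c 3).Adelic) * y) = ((χ₁ (diagUnit (t : borelAdelic F E c 3).2 0) : ℂˣ) : ℂ) * ((χ₂ (middleEntryUnitary (t : borelAdelic F E c 3).2) : ℂˣ) : ℂ) * φ y := by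
  rw [hφ.borel_mul (t : borelAdelic F E c 3).2, firstEntryUnit_eq_diagUnit_zero]

/-- **`H(t k) = ‖d₀ t‖`** for `t ∈ T(𝔸_F)`, `k ∈ K_U` (★ `borelHeight_mul_of_mem_comap_standardMaximalCompactGL`, ★ `borelHeight_coe_eq_ideleNorm_diagUnit`, every rank). [cite: Rogawski1990, §2.2 p. 13] -/
theorem borelHeight_torus_mul_maximalCompact_three (t : ↥(torusInBorel F E c 3)) (k : ((standardMaximalCompactGL 3 E).comap (adelicVal F E c 3 ((StdForm.antidiagonal 3).over E)) : Subgroup (quasiSplit F E c 3).Adelic)) :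
    borelHeight (((t : borelAdelic F E c 3) : (quasiSplit F E c 3).Adelic) * (k : (quasiSplit F E c 3).Adelic)) = (IdeleClassGroup.ideleNorm E (diagUnit (t : borelAdelic F E c 3).2 0)) := by
  rw [borelHeight_mul_of_mem_comap_standardMaximalCompactGL k.2, K2E1BorelParabolicIntegralU3.borelHeight_coe_eq_ideleNorm_diagUnit]

/-! ## §2 Torus scaling of the intertwining integral of a pair section, `d₀`-currency (`δ_B = ‖d₀‖²`) -/

variable [MeasurableSpace (quasiSplit F E c 3).Adelic] [BorelSpace (quasiSplit F E c 3).Adelic]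

/-- **`I(z, t y) = ‖d₀‖²·χ₁ʷ(d₀)·χ₂(t₁₁)·(‖d₀‖⁻¹)^z·I(z, y)`**, `I(z, g) = ∫_{N(𝔸)} (φ·H^z)(w₀ v g) dν`, `d₀ = d₀ t`, for a Borel `(χ₁, χ₂)`-pair-section `φ` of `U(J₃)` (`c² = 1`, `c ≠ 1`), a Haar `ν`
on `N(𝔸)`, every `z`, `t ∈ T(𝔸_F)`, `y` — ★ row 4a `integral_flatSectionU_weylLongU_torus_mul_of_isChiSectionPair` at `d = diagUnit t` (★ `glDiagonal_diagUnit_torus`) with `δ_B(t) = ‖d₀‖²`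
(★ `torusRootModulus_diagUnit_torus_eq_ideleNorm_mul`) and `χ₁(d₂) = χ₁ʷ(d₀)` (★ `chi_torus_last_eq_reflectChar`). [cite: MoeglinWaldspurger1995, II.1.6] [cite: GelbartRogawski1991, §3.1] -/
theorem integral_flatSectionU_weylLongU_torus_mul_eq_diagUnit_three (hc : c * c = 1) (hc1 : c ≠ 1) (ν : Measure ↥(adelicUnipotent F E c 3)) [ν.IsHaarMeasure]
    {χ₁ : HeckeCharacter E} {χ₂ : ↥(TorusDict.torus c) →ₜ* ℂˣ} {φ : (quasiSplit F E c 3).Adelic → ℂ} (hφ : IsChiSectionPair χ₁ χ₂ φ) (hφm : Measurable φ)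
    (t : ↥(torusInBorel F E c 3)) (z : ℂ) (y : (quasiSplit F E c 3).Adelic) :
    ∫ v : ↥(adelicUnipotent F E c 3), flatSectionU φ z (((quasiSplit F E c 3).toAdelic (weylLongU (c : E →+* E) (rfl : (StdForm.antidiagonal 3).over E = (StdForm.antidiagonal 3).over E))) * ((v : (quasiSplit F E c 3).Adelic) * (((t : borelAdelic F E c 3) : (quasiSplit F E c 3).Adelic) * y))) ∂ν =
      ((((IdeleClassGroup.ideleNorm E (diagUnit (t : borelAdelic F E c 3).2 0)) : ℝ≥0) : ℝ) : ℂ) * ((((IdeleClassGroup.ideleNorm E (diagUnit (t : borelAdelic F E c 3).2 0)) : ℝ≥0) : ℝ) : ℂ) *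
        (((reflectChar c χ₁ (diagUnit (t : borelAdelic F E c 3).2 0) : ℂˣ) : ℂ) * ((χ₂ (middleEntryUnitary (t : borelAdelic F E c 3).2) : ℂˣ) : ℂ) * (((((IdeleClassGroup.ideleNorm E (diagUnit (t : borelAdelic F E c 3).2 0)))⁻¹ : ℝ≥0) : ℝ) : ℂ) ^ z) *
        ∫ v : ↥(adelicUnipotent F E c 3), flatSectionU φ z (((quasiSplit F E c 3).toAdelic (weylLongU (c : E →+* E) (rfl : (StdForm.antidiagonal 3).over E = (StdForm.antidiagonal 3).over E))) * ((v : (quasiSplit F E c 3).Adelic) * y)) ∂ν := by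
  have hd := glDiagonal_diagUnit_torus (F := F) (E := E) (c := c) (N := 3) t
  rw [integral_flatSectionU_weylLongU_torus_mul_of_isChiSectionPair hc hc1 ν hφ hφm t hd z y, torusRootModulus_diagUnit_torus_eq_ideleNorm_mul, chi_torus_last_eq_reflectChar χ₁ t hd,
    NNReal.coe_mul, Complex.ofReal_mul]

/-! ## §3 The two `K_U`-averages along `t·K_U` (the bracket data of the unfolded pair inner product) -/

omit [BorelSpace (quasiSplit F E c 3).Adelic] in
/-- **`∫_{K_U} g₁(H(tk))·φ(tk)·conj(g₂(H(tk))·φ′(tk)) dμ_K = g₁(‖d₀‖)·conj g₂(‖d₀‖)·(χ₁(d₀)·conj χ₁′(d₀))·(χ₂(t₁₁)·conj χ₂′(t₁₁))·∫_{K_U} φ·conj φ′ dμ_K`** for pair sections `φ`, `φ′` of data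
`(χ₁, χ₂)`, `(χ₁′, χ₂′)`, any `g₁ g₂ : ℝ → ℂ`, any measure `μ_K` on `K_U`, every `t ∈ T(𝔸_F)` — the `w = 1` term's `K_U`-average; TORUS CHARACTER `η_1 = (χ₁·conj χ₁′)∘d₀ · (χ₂·conj χ₂′)∘(·)₁₁`
(non-trivial on the `U(1)`-fibre iff `χ₂ ≠ χ₂′`; on `d₀` a norm twist iff `χ₁′ = χ₁` up to `‖·‖^{it}`). [cite: MoeglinWaldspurger1995, II.2.1] [cite: Rogawski1990, §7.3] -/
theorem integral_maximalCompact_torus_chiSectionPair_mul_conj (μK : Measure ((standardMaximalCompactGL 3 E).comap (adelicVal F E c 3 ((StdForm.antidiagonal 3).over E)) : Subgroup (quasiSplit F E c 3).Adelic))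
    {χ₁ χ₁' : HeckeCharacter E} {χ₂ χ₂' : ↥(TorusDict.torus c) →ₜ* ℂˣ} {φ φ' : (quasiSplit F E c 3).Adelic → ℂ} (hφ : IsChiSectionPair χ₁ χ₂ φ) (hφ' : IsChiSectionPair χ₁' χ₂' φ')
    (g₁ g₂ : ℝ → ℂ) (t : ↥(torusInBorel F E c 3)) :
    ∫ k : ((standardMaximalCompactGL 3 E).comap (adelicVal F E c 3 ((StdForm.antidiagonal 3).over E)) : Subgroup (quasiSplit F E c 3).Adelic),
        g₁ (borelHeight (((t : borelAdelic F E c 3) : (quasiSplit F E c 3).Adelic) * (k : (quasiSplit F E c 3).Adelic)) : ℝ) * φ (((t : borelAdelic F E c 3) : (quasiSplit F E c 3).Adelic) * (k : (quasiSplit F E c 3).Adelic)) *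
          conj (g₂ (borelHeight (((t : borelAdelic F E c 3) : (quasiSplit F E c 3).Adelic) * (k : (quasiSplit F E c 3).Adelic)) : ℝ) * φ' (((t : borelAdelic F E c 3) : (quasiSplit F E c 3).Adelic) * (k : (quasiSplit F E c 3).Adelic))) ∂μK =
      g₁ ((IdeleClassGroup.ideleNorm E (diagUnit (t : borelAdelic F E c 3).2 0)) : ℝ) * conj (g₂ ((IdeleClassGroup.ideleNorm E (diagUnit (t : borelAdelic F E c 3).2 0)) : ℝ)) *
        (((χ₁ (diagUnit (t : borelAdelic F E c 3).2 0) : ℂˣ) : ℂ) * conj (((χ₁' (diagUnit (t : borelAdelic F E c 3).2 0) : ℂˣ) : ℂ))) * (((χ₂ (middleEntryUnitary (t : borelAdelic F E c 3).2) : ℂˣ) : ℂ) * conj (((χ₂' (middleEntryUnitary (t : borelAdelic F E c 3).2) : ℂˣ) : ℂ))) *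
        ∫ k : ((standardMaximalCompactGL 3 E).comap (adelicVal F E c 3 ((StdForm.antidiagonal 3).over E)) : Subgroup (quasiSplit F E c 3).Adelic), φ (k : (quasiSplit F E c 3).Adelic) * conj (φ' (k : (quasiSplit F E c 3).Adelic)) ∂μK := by
  rw [← integral_const_mul]
  refine integral_congr_ae (Filter.Eventually.of_forall fun k => ?_)
  simp only [borelHeight_torus_mul_maximalCompact_three t k, apply_torus_mul_of_isChiSectionPair hφ t, apply_torus_mul_of_isChiSectionPair hφ' t, map_mul]
  ring

/-- **THE INTERTWINED TERM'S `K_U`-AVERAGE**: for a pair section `φ` of `(χ₁, χ₂)`, a Borel pair section `φ′` of `(χ₁′, χ₂′)`, `g₁ G : ℝ → ℂ`, `σ₀ : ℝ`, `t ∈ T(𝔸_F)`, with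
`I(z, g) := ∫_{N(𝔸)} (φ′·H^z)(w₀ v g) dν`:  `∫_{K_U} g₁(H(tk))·φ(tk)·conj(∫_ℝ G(y)·I(σ₀+iy, tk) dy) dμ_K =
g₁(‖d₀‖)·χ₁(d₀)·χ₂(t₁₁)·∫_{K_U} φ(k)·conj(∫_ℝ G(y)·(‖d₀‖²·χ₁′ʷ(d₀)·χ₂′(t₁₁)·(‖d₀‖⁻¹)^{σ₀+iy})·I(σ₀+iy, k) dy) dμ_K` — POINTWISE rewrites (§1, §2) under the two integral signs; TORUS
CHARACTER of the term (after pulling the `t`-constants out of `conj`): `η_{w₀} = (χ₁·conj χ₁′ʷ)∘d₀ · (χ₂·conj χ₂′)∘(·)₁₁` — the `w = w₀` term lives on the ASSOCIATE pair `((χ₁′)ʷ, χ₂′)`.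
[cite: MoeglinWaldspurger1995, II.2.1] [cite: Rogawski1990, §7.3] -/
theorem integral_maximalCompact_torus_chiSectionPair_mul_conj_intertwined (hc : c * c = 1) (hc1 : c ≠ 1) (ν : Measure ↥(adelicUnipotent F E c 3)) [ν.IsHaarMeasure]
    (μK : Measure ((standardMaximalCompactGL 3 E).comap (adelicVal F E c 3 ((StdForm.antidiagonal 3).over E)) : Subgroup (quasiSplit F E c 3).Adelic))
    {χ₁ χ₁' : HeckeCharacter E} {χ₂ χ₂' : ↥(TorusDict.torus c) →ₜ* ℂˣ} {φ φ' : (quasiSplit F E c 3).Adelic → ℂ} (hφ : IsChiSectionPair χ₁ χ₂ φ) (hφ' : IsChiSectionPair χ₁' χ₂' φ') (hφ'm : Measurable φ')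
    (g₁ : ℝ → ℂ) (G : ℝ → ℂ) (σ₀ : ℝ) (t : ↥(torusInBorel F E c 3)) :
    ∫ k : ((standardMaximalCompactGL 3 E).comap (adelicVal F E c 3 ((StdForm.antidiagonal 3).over E)) : Subgroup (quasiSplit F E c 3).Adelic),
        g₁ (borelHeight (((t : borelAdelic F E c 3) : (quasiSplit F E c 3).Adelic) * (k : (quasiSplit F E c 3).Adelic)) : ℝ) * φ (((t : borelAdelic F E c 3) : (quasiSplit F E c 3).Adelic) * (k : (quasiSplit F E c 3).Adelic)) *
          conj (∫ y : ℝ, G y * ∫ v : ↥(adelicUnipotent F E c 3), flatSectionU φ' ((σ₀ : ℂ) + y * Complex.I)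
            (((quasiSplit F E c 3).toAdelic (weylLongU (c : E →+* E) (rfl : (StdForm.antidiagonal 3).over E = (StdForm.antidiagonal 3).over E))) * ((v : (quasiSplit F E c 3).Adelic) * (((t : borelAdelic F E c 3) : (quasiSplit F E c 3).Adelic) * (k : (quasiSplit F E c 3).Adelic)))) ∂ν) ∂μK =
      g₁ ((IdeleClassGroup.ideleNorm E (diagUnit (t : borelAdelic F E c 3).2 0)) : ℝ) * (((χ₁ (diagUnit (t : borelAdelic F E c 3).2 0) : ℂˣ) : ℂ) * ((χ₂ (middleEntryUnitary (t : borelAdelic F E c 3).2) : ℂˣ) : ℂ)) *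
        ∫ k : ((standardMaximalCompactGL 3 E).comap (adelicVal F E c 3 ((StdForm.antidiagonal 3).over E)) : Subgroup (quasiSplit F E c 3).Adelic),
          φ (k : (quasiSplit F E c 3).Adelic) *
            conj (∫ y : ℝ, G y * (((((IdeleClassGroup.ideleNorm E (diagUnit (t : borelAdelic F E c 3).2 0)) : ℝ≥0) : ℝ) : ℂ) * ((((IdeleClassGroup.ideleNorm E (diagUnit (t : borelAdelic F E c 3).2 0)) : ℝ≥0) : ℝ) : ℂ) *
              (((reflectChar c χ₁' (diagUnit (t : borelAdelic F E c 3).2 0) : ℂˣ) : ℂ) * ((χ₂' (middleEntryUnitary (t : borelAdelic F E c 3).2) : ℂˣ) : ℂ) * (((((IdeleClassGroup.ideleNorm E (diagUnit (t : borelAdelic F E c 3).2 0)))⁻¹ : ℝ≥0) : ℝ) : ℂ) ^ ((σ₀ : ℂ) + y * Complex.I)) *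
              ∫ v : ↥(adelicUnipotent F E c 3), flatSectionU φ' ((σ₀ : ℂ) + y * Complex.I) (((quasiSplit F E c 3).toAdelic (weylLongU (c : E →+* E) (rfl : (StdForm.antidiagonal 3).over E = (StdForm.antidiagonal 3).over E))) * ((v : (quasiSplit F E c 3).Adelic) * (k : (quasiSplit F E c 3).Adelic))) ∂ν)) ∂μK := by
  rw [← integral_const_mul]
  refine integral_congr_ae (Filter.Eventually.of_forall fun k => ?_)
  simp only [borelHeight_torus_mul_maximalCompact_three t k, apply_torus_mul_of_isChiSectionPair hφ t,
    integral_flatSectionU_weylLongU_torus_mul_eq_diagUnit_three hc hc1 ν hφ' hφ'm t]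
  ring

end Summit.HodgeConjecture.HodgeConjecture.Cruxes.H413.K2E1ChiSectionTorusAverageU3

end
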